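import Literature.MathematicalPhysics.QuantumFieldTheory.Balaban1983to89.Node00.N24KnitStage11Carriers
import Literature.MathematicalPhysics.QuantumFieldTheory.Balaban1983to89.B14NodeKnitRecord11R
import Literature.MathematicalPhysics.QuantumFieldTheory.Balaban1983to89.Node00.Record11Beta

/-!
# NODE N24 · (B2) AT NODE 00's STAGE-11 RECORD `IsRecordOfRecord₁₁C` WITH N09 AND N11 ENTERED AT THE RECORD'S OWN PARAMETERS BY NAME — seat dag-n11-e's print-faithful
# Stage-11 N11 (`B14NodeKnitRecord11R`: the 𝐑-antecedent consumed FROM THE NODE'S OWN ANTECEDENT through the leaf at the carriers of record) replaces module 20's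
# binder `h11`; the four-pin carrier chain `₁₁CB10YZW` in the same currency

TRACK A (YM-PLAN §2d, node N24 of 28 = binder B2 `hB : B16.EndStatementBPrinted D.C`), seat `pub-ymgap-dag-n24-c` (R134 fan-out seat, strategy s2).  TWENTY-SECOND N24
module, a NEW importing one (modules 1–21 untouched; sequel of modules 20 `N24GlueStage11C` and 21 `N24KnitStage11Carriers`).  THEOREMS ONLY, def-free, sorry-free,
standard axioms.

WHY.  Module 20 displayed N11 as the by-name binder `∀ P, Dag.B14_main (leavesP w P)`.  Seat dag-n11-e's `B14NodeKnitRecord11R.b14_main_at_record₁₁_of_rOpLeaf` (p450829,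
Literature side) gives `Dag.B14_main (leavesP w P)` AT A WORLD BOUND TO THE STAGE-11 DATUM from two DISPLAYED, PRINTED slots at the objects of record — (S0) «interval ⇒ the
Wilson start `ρ₀` of record has the §2 [Balaban1988Convergent] form», `smallCouplings → SLaw₁₁ θ P 0`; (S1ᵀ) «the Theorem of p. 245 at the objects of record GIVEN the node's
in-edges `b7 … b11`, the interval hypothesis, the small-field inductive assumptions and the flow control», `… → ∀ k < K, SLaw₁₁ θ P k → TLaw₁₁ θ P k` — with the (𝐑) step
SUPPLIED BY THE NODE'S OWN ANTECEDENT `rOperation`, read through the leaf at the carriers of record `ROpLeaf (VOfRecord₁₁ F N θ P)` (`rOperation_iff_rOpLeaf₁₁`, `Iff.rfl` at the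
C-binding) — PRINT-FAITHFUL ([Balaban1988Convergent] p. 244 ASSUMES 𝐑): N24 supplies NO 𝐑-hypothesis for N11.  This module keys that theorem over every presentation of a
₁₁C record (§0) and re-knits module 20's `N24_at_record₁₁C_knit_N09_pinned` with it (§1): EVERY paper child except N13 now enters at θ₁₁ by name; **N13** stays WORLD-LEVEL
(the record's 𝐑-leaf `hR : ∀ P, (w.up P).rOperation` — N13's own product, `Dag.B16_main`'s first conjunct — + the Cor.-3 leaves `hcor3`) until the Literature-side ₁₁ twin
of `B16NodeKnitRecord10` (seat dag-n13-e, announced) lands; it is consumed by name in an append-only successor.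

WHAT THIS FILE PROVES.
§0 `N24_b14_main_of_isRecordOfRecord₁₁C_of_slots` — N11 at every run of a ₁₁C record from the θ-keyed slots (S0), (S1ᵀ) (dag-n11-e's theorem keyed over the record).
§1 **`N24_at_record₁₁C_knit_N09_N11_pinned`** — (B2) at a ₁₁C record: six residual-carrier sockets (module 20 §0), N09 ×4 (dag-n09-d), N11 ×2 slots (dag-n11-e), N13
   world-level, β-box.  NO PURE NODE BINDER.  `N24_at_record₁₁C_knit_N09_N11_of_betaMerged_pinned` — β read at the merged β over `mergedTermFamilyMatT (TcOfRecord)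
   (chiFixed7 θ.ν)` along `]0, w.γ]^{k+1}` (module 20 §2's iffs); **`N24_at_record₁₁C_knit_N09_N11_of_betaMergedOfRecord₁₁_pinned`** — THE β-SEAM RE-KEYED BY NAME to the
   β-side definer's `Node00/Record11Beta` (seat node00-def-B, p451949): the two β-bounds on `betaMergedOfRecord₁₁ F N θ` along `]0, w.γ]`, transported by def-B's
   `βfun_datumOfRecord₁₁_eq_betaOfRecord₁₁` ∕ `betaLowerH_betaOfRecord₁₁_iff` ∕ `betaUpperH_betaOfRecord₁₁_iff` (LINE №45 (2)'s «β binder over ₁₁C» now NAMED).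
§2 **`N24_stabilityBR11e_shape₁₁C_knit_N09_N11_pinned`** — item K1 `StabilityBAtRecordR11e`'s CONSEQUENT BODY in its literal shape at general `N`, witnessed by the record at
   hand, with these hypotheses; `N24_stabilityBR11e_consequent₁₁C_knit_N09_N11_pinned` (its `∃ D w` form).
§3 **`N24_at_record₁₁CB10YZW_knit_all_carriers_N09_N11_pinned`** — the same knit at the top of g31's four-pin chain (same `(D, w)`): N08 ← the printed slot
   `PrintedUV3V N L`; N06 ∧ N07 ∧ N12 ← the hidden layers' leaves; N05 ∕ N10 θ-keyed sockets; N09 ×4; N11 ×2; N13 world-level; β-box (module 21 §1's recipe).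
   (The five-pin record `₁₁CB10YZWB8` keeps N09 ∕ N11 as binders — module 21 §2 —: their DAG sentences read `b8`, so by ref-C's rule (B8-2) their re-key to the S-bound world
   ports through the owners' `nodes_iff_bundles` faces, not through N24.)

WHICH CHILD BLOCKS AT ₁₁C (kernel form = hypothesis list of `N24_at_record₁₁C_knit_N09_N11_of_betaMerged_pinned`): NO pure `Dag.Bk_main` binder.  THEOREMS inside —
N01 N02 N03 N04, guarded (0.20), `0 < γ`, `w.C = D.C`.  SIX θ-keyed RESIDUAL-CARRIER SOCKETS ∕ SLOTS over `θ.toStage5₁₁` with the pin clause (X-[B8] ∕ X-[B10] ∕ X-B13, Y,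
Z, W; five of them pinned on g31's chains — §3 and module 21).  N09 ×4 (B12-group pin slot over the FREE B12 group — NODE 00's `CarriersB12` owed —, [Balaban1985Variational]
Thm 1 on `domAltOfRecord` ×3).  N11 ×2 ((S0), (S1ᵀ) at `SLaw₁₁ ∕ TLaw₁₁` — the §2 [III] form PINNED at ₁₁, no residual format predicate).  N13: the 𝐑-leaf `hR` (at ₁₁ =
«𝐓-image form ⇒ §2 form one level up», Theorem 2's statement shape; seat dag-n13-c's located typing finding on the (S)-pin's sequence quantifier stands until def-T ∕ def-R's
repair) + `hcor3`.  β ×2 on the merged β over the continuous-version transport (lower `b > 0` UNPRINTED, T09.F = NODE O — the β-side definer's binder over ₁₁C; upper β⁺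
[Balaban1987RG1] p. 264).  INHABITATION — item K0 `Record11Inhabited` at `N ≥ 2`, OWED.
VACUITY STATUS AT ₁₁ AS PINNED (seat dag-n13-e's LOCATED TYPING FLAG, cell bus 2026-08-26T15:10Z, kernel-certified in its probes, its files pending; seat dag-n13-c's
(S)-pin census `B16RLeafRecord11` p453422; def-T's WORD: repair BY ONE PIN in the successor record `Node00/Record12`).  AS PINNED AT STAGE 11 the level-0 background map of
record does not read the field (the (2.12) constraint over the empty generating set is vacuous), so the level-0 §2 slot is a CONSTANT function and the (S0) slot displayed
below, `smallCouplings → SLaw₁₁ θ P 0`, is UNSATISFIABLE at `N ≥ 2` on every in-window run with `g₀ ≠ 0`; by the same census (B) `B16.EndStatementBPrinted D.C` itself FAILS at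
every Stage-11 record whose runs enter a coupling window.  CONSEQUENCE FOR THIS FILE (and for modules 20–21): every (B2) knit at ₁₁ is a CORRECT IMPLICATION WHOSE HYPOTHESES
ARE JOINTLY UNSATISFIABLE at such records — the WIRING of record (which child feeds which slot, by name), NOT evidence that (B2) is reachable at ₁₁; the live currency is the
repaired Stage-12 record, where this wiring is re-keyed by name (children's ₁₂ junctions as they land).  Nothing here hides that: the (S0) slot stays DISPLAYED verbatim.
HONEST FRAMING: kernel bookkeeping BY NAME; nothing of Bałaban's asserted; every slot DISPLAYED; N24 COMPOSITE — no discharge, no count; one finite T⁴ programme at fixed ε;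
NOT continuum ∕ ℝ⁴ ∕ OS ∕ mass gap ∕ Clay.
-/

noncomputable section

open scoped Matrix.Norms.L2Operator

namespace Literature.MathematicalPhysics.QuantumFieldTheory.Balaban1983to89.Node00

open DagBinding T4Continuum T4DatumAssembly FlowStepRuns AveragingRT
open FlowStep (box_mono)

variable {F : T4Family} {N : ℕ} [NeZero N] {D : FiniteEpsData F (SU N)} {w : WorldP}

/-! ## §0. N11 at every run of a Stage-11 record from the θ-keyed slots (S0), (S1ᵀ) — dag-n11-e's print-faithful theorem keyed over the record -/

/-- **N11 · [Balaban1988Convergent] AT EVERY RUN OF A STAGE-11 RECORD FROM THE θ-KEYED SLOTS (S0), (S1ᵀ)** — seat dag-n11-e's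
`B14NodeKnitRecord11R.b14_main_at_record₁₁_of_rOpLeaf` at the presenting `(θ, h)` of the record: the world IS bound to the datum's construction (`w.C = D.C`,
`D = datumOfRecord₁₁ θ h`), the reading (P1) `rOperation → ROpLeaf (VOfRecord₁₁ θ P)` IS `rOperation_iff_rOpLeaf₁₁` at the record's binding equation, and the slots are
«(S0) interval ⇒ `SLaw₁₁ θ P 0`» ∧ «(S1ᵀ) in-edges ⇒ interval ⇒ small-field assumptions ⇒ flow control ⇒ `∀ k < K, SLaw₁₁ θ P k → TLaw₁₁ θ P k`» at the objects of record;
the (𝐑) step comes from the node's OWN antecedent (print-faithful: p. 244 assumes 𝐑). [cite: Balaban1988Convergent, Thm 1 p.262, Theorem p.245, p.244 (node bookkeeping at the Stage-11 record)] -/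
theorem N24_b14_main_of_isRecordOfRecord₁₁C_of_slots (h : IsRecordOfRecord₁₁C F N D w)
    (slots₁₁ : ∀ (θ : Stage11Params F N) (hP : θ.Provisos₁₁), θ.Admissible → D = datumOfRecord₁₁ F N θ hP →
      (∀ P, w.up P = upOfRecord₅C F N (θ.toStage5₁₁ F N) P) → ∀ P : B12.RunParams,
        ((leavesP w P).smallCouplings → SLaw₁₁ F N θ P 0) ∧
        ((leavesP w P).b7 → (leavesP w P).b8 → (leavesP w P).b9 → (leavesP w P).b10 → (leavesP w P).b11 →
          (leavesP w P).smallCouplings → (leavesP w P).smallFieldInductive → (leavesP w P).flowControl →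
            ∀ k, k < P.K → SLaw₁₁ F N θ P k → TLaw₁₁ F N θ P k))
    (P : B12.RunParams) : Dag.B14_main (leavesP w P) := by
  obtain ⟨θ, hP, hθ, hD, hC, -, -, hup⟩ := h
  obtain ⟨h0, hT⟩ := slots₁₁ θ hP hθ hD hup P
  exact B14NodeKnitRecord11R.b14_main_at_record₁₁_of_rOpLeaf F N θ hP w P (by rw [hC, hD])
    (B14NodeKnitRecord11R.rOperation_iff_rOpLeaf₁₁ F N θ w P (hup P)).1 h0 hT

/-! ## §1. (B2) at the Stage-11 record, N09 and N11 by name, N13 world-level -/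

/-- **N24 · (B2) AT THE STAGE-11 RECORD, EVERY PAPER CHILD BUT N13 ENTERED AT THE RECORD'S OWN PARAMETERS BY NAME.**  N01 N02 N03 N04 theorems (inside module 20's engine);
N05 N06 N07 N12 θ-keyed pinned carrier sockets on the residual groups X ∕ Y ∕ Z ∕ W over `θ.toStage5₁₁` (module 20 §0); N08 the leaf-system slot; N10 the B13 socket; **N09**
seat dag-n09-d's `B12NodeKnitRecord11.b12_main_at_record₁₁C_of_leaf` (`slot12`, `h11dom`, `hres`, `huniq`); **N11** seat dag-n11-e's print-faithful theorem (§0: (S0) ∧ (S1ᵀ),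
𝐑 from the node's own antecedent); **N13** world-level — the record's 𝐑-leaf `hR` + the Cor.-3 leaves `hcor3` (module 20's `N24_at_record₁₁C_of_N13_leaf`); β-box on `D.βfun`
over `]0, γ₀]`.  NO PURE NODE BINDER. [cite: Balaban1989LargeFieldII, Thm 1 p.355, (0.1) pp.355–356, p.387, p.391; Balaban1988Convergent, Thm 1 p.262, Thm 2 p.263, Theorem p.245, p.244, Cor. 3 (2.50) p.264; Balaban1987RG1, Thm 1 p.259, Thm 3 p.264, Lemma 4 (3.53) p.280, (1.1)–(1.3) p.260, (1.22) p.264; Balaban1985Variational, Thm 1 (8)–(10) p.279; Balaban1985RegularSpaces, Thms 2, 4, 8 pp.83–101; Balaban1985BackgroundPropagators, Thms 3.1–3.15 pp.397–432; Balaban1985UV3, Thm 1 p.257 + Thm 2 p.272; Balaban1988RG2Cluster, Lemmas 1–3 pp.9, 11, 20; Balaban1989LargeFieldI, Prop. 1 p.194; Balaban1984PropagatorsII, pp.234–249 (bookkeeping over the Stage-11 record)] -/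
theorem N24_at_record₁₁C_knit_N09_N11_pinned (h : IsRecordOfRecord₁₁C F N D w) {γ₀ : ℝ} (hγ₀ : w.γ ≤ γ₀)
    (slots₀₅ : ∀ (θ : Stage11Params F N) (hP : θ.Provisos₁₁), θ.Admissible → D = datumOfRecord₁₁ F N θ hP →
      (∀ P, w.up P = upOfRecord₅C F N (θ.toStage5₁₁ F N) P) → ∀ P : B12.RunParams,
        B8LeafR (θ.res.X P).d8 (θ.res.X P).L8 (θ.res.X P).C₂ (θ.res.X P).B₁' (θ.res.X P).B₀' (θ.res.X P).B₁ (θ.res.X P).B₂ (θ.res.X P).c₁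
          (θ.res.X P).inp8 (θ.res.X P).B₀β (θ.res.X P).loc8 (θ.res.X P).fam8R (θ.res.X P).lan8 (θ.res.X P).cub8 (θ.res.X P).toAxial8)
    (slots₀₆ : ∀ (θ : Stage11Params F N) (hP : θ.Provisos₁₁), θ.Admissible → D = datumOfRecord₁₁ F N θ hP →
      (∀ P, w.up P = upOfRecord₅C F N (θ.toStage5₁₁ F N) P) → ∀ P : B12.RunParams, B9LeafX (θ.res.Y P))
    (slots₀₇ : ∀ (θ : Stage11Params F N) (hP : θ.Provisos₁₁), θ.Admissible → D = datumOfRecord₁₁ F N θ hP →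
      (∀ P, w.up P = upOfRecord₅C F N (θ.toStage5₁₁ F N) P) → ∀ P : B12.RunParams, B11Leaf (θ.res.Z P))
    (slots₀₈ : ∀ (θ : Stage11Params F N) (hP : θ.Provisos₁₁), θ.Admissible → D = datumOfRecord₁₁ F N θ hP →
      (∀ P, w.up P = upOfRecord₅C F N (θ.toStage5₁₁ F N) P) → ∀ P : B12.RunParams,
        ∃ (Xc : PrintedCarriersR) (I : Type) (C : B10Assembly.Consts) (T : I → B10.TowerRun),
          Nonempty (∀ i, B10Assembly.LeafSystem C (T i)) ∧ θ.res.X P = Xc.withTowerRuns10 T)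
    (slot12 : ∀ (θ : Stage11Params F N) (hP : θ.Provisos₁₁), θ.Admissible → D = datumOfRecord₁₁ F N θ hP → w.γ ≤ θ.γ →
      (∀ P, w.up P = upOfRecord₅C F N (θ.toStage5₁₁ F N) P) → ∀ P : B12.RunParams, B12Sec2to5.Lemma4Printed (θ.res.X P).F12 (θ.res.X P).c12)
    (h11dom : ∀ (θ : Stage11Params F N) (hP : θ.Provisos₁₁), θ.Admissible → D = datumOfRecord₁₁ F N θ hP → w.γ ≤ θ.γ →
      ∀ (p : B12.RunParams) (k : ℕ), k ≤ p.K →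
        ∀ V ∈ domAltOfRecord F N θ.ν p.K k, UkExists F N p.K k θ.εbg V ∧ UniqueUkOrbit F N p.K k θ.εbg V)
    (hres : ∀ (θ : Stage11Params F N) (hP : θ.Provisos₁₁), θ.Admissible → D = datumOfRecord₁₁ F N θ hP → w.γ ≤ θ.γ →
      ∀ (p : B12.RunParams) (k : ℕ), k ≤ p.K → HRestrict F N θ.εbg p.K k (domAltOfRecord F N θ.ν p.K k))
    (huniq : ∀ (θ : Stage11Params F N) (hP : θ.Provisos₁₁), θ.Admissible → D = datumOfRecord₁₁ F N θ hP → w.γ ≤ θ.γ →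
      ∀ (p : B12.RunParams) (k : ℕ), k ≤ p.K → ∀ V ∈ domAltOfRecord F N θ.ν p.K k, ∀ j < k,
        UniqueUkOrbit F N p.K (j + 1) θ.εbg (Averaging.iter (avOfRecord F N p.K) (j + 1) (Uk F N p.K k θ.εbg V)))
    (slots₁₀ : ∀ (θ : Stage11Params F N) (hP : θ.Provisos₁₁), θ.Admissible → D = datumOfRecord₁₁ F N θ hP →
      (∀ P, w.up P = upOfRecord₅C F N (θ.toStage5₁₁ F N) P) → ∀ P : B12.RunParams,
        B9LeafX (θ.res.Y P) →
          (B10.Thm1PrintedCompact (θ.res.X P).runs10 ∧ B10.Thm2Printed (θ.res.X P).runs10) →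
            B11Leaf (θ.res.Z P) → B12Sec2to5.Lemma4Printed (θ.res.X P).F12 (θ.res.X P).c12 →
              B13.Lemma1Printed (θ.res.X P).S13 (θ.res.X P).c13 ∧ B13.Lemma2Printed (θ.res.X P).S13 (θ.res.X P).c13 ∧
                B13.Lemma3Printed (θ.res.X P).S13 (θ.res.X P).c13)
    (slots₁₁ : ∀ (θ : Stage11Params F N) (hP : θ.Provisos₁₁), θ.Admissible → D = datumOfRecord₁₁ F N θ hP →
      (∀ P, w.up P = upOfRecord₅C F N (θ.toStage5₁₁ F N) P) → ∀ P : B12.RunParams,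
        ((leavesP w P).smallCouplings → SLaw₁₁ F N θ P 0) ∧
        ((leavesP w P).b7 → (leavesP w P).b8 → (leavesP w P).b9 → (leavesP w P).b10 → (leavesP w P).b11 →
          (leavesP w P).smallCouplings → (leavesP w P).smallFieldInductive → (leavesP w P).flowControl →
            ∀ k, k < P.K → SLaw₁₁ F N θ P k → TLaw₁₁ F N θ P k))
    (slots₁₂ : ∀ (θ : Stage11Params F N) (hP : θ.Provisos₁₁), θ.Admissible → D = datumOfRecord₁₁ F N θ hP →
      (∀ P, w.up P = upOfRecord₅C F N (θ.toStage5₁₁ F N) P) → ∀ P : B12.RunParams, B15Leaf (θ.res.W P))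
    (hR : ∀ P : B12.RunParams, (w.up P).rOperation)
    (hcor3 : ∃ (em ep : ℝ → ℝ) (R : B14Cor3.ReprFamily D.C),
      B14Cor3.LeafH D.C R w.γ ∧ B14Cor3.LeafU1 D.C R w.γ ∧ B14Cor3.LeafU2 D.C R w.γ ep ∧ B14Cor3.LeafL1 D.C R w.γ ∧ B14Cor3.LeafL2 D.C R w.γ em)
    (hlo : FlowStep.BetaLowerH w.b γ₀ D.βfun) (hhi : FlowStep.BetaUpperH w.βup γ₀ D.βfun) :
    B16.EndStatementBPrinted D.C :=
  N24_at_record₁₁C_knit_N09_pinned h hγ₀ slots₀₅ slots₀₆ slots₀₇ slots₀₈ slot12 h11dom hres huniq slots₁₀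
    (N24_b14_main_of_isRecordOfRecord₁₁C_of_slots h slots₁₁) slots₁₂ hR hcor3 hlo hhi

/-- **The same with the β-binders READ AT THE MERGED β over `mergedTermFamilyMatT (TcOfRecord) (chiFixed7 θ.ν)` along the world's own box `]0, w.γ]^{k+1}`** (module 20's
`N24_betaLowerH_iff_merged₁₁` ∕ `N24_betaUpperH_iff_merged₁₁` at the presenting `θ`).  ITS HYPOTHESIS LIST IS «WHICH CHILD BLOCKS AT ₁₁C» IN KERNEL FORM (file header).
[cite: Balaban1989LargeFieldII, Thm 1 p.355, (0.1) pp.355–356, p.391; Balaban1987RG1, (0.19) p.255, (1.20)–(1.22) p.264, (2.12)–(2.14) p.268, Thm 3 p.264, Lemma 4 (3.53) p.280; Balaban1988Convergent, Thm 1 p.262, Theorem p.245, p.244; Balaban1985Variational, Thm 1 p.279 (bookkeeping over the Stage-11 record)] -/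
theorem N24_at_record₁₁C_knit_N09_N11_of_betaMerged_pinned (h : IsRecordOfRecord₁₁C F N D w)
    (slots₀₅ : ∀ (θ : Stage11Params F N) (hP : θ.Provisos₁₁), θ.Admissible → D = datumOfRecord₁₁ F N θ hP →
      (∀ P, w.up P = upOfRecord₅C F N (θ.toStage5₁₁ F N) P) → ∀ P : B12.RunParams,
        B8LeafR (θ.res.X P).d8 (θ.res.X P).L8 (θ.res.X P).C₂ (θ.res.X P).B₁' (θ.res.X P).B₀' (θ.res.X P).B₁ (θ.res.X P).B₂ (θ.res.X P).c₁
          (θ.res.X P).inp8 (θ.res.X P).B₀β (θ.res.X P).loc8 (θ.res.X P).fam8R (θ.res.X P).lan8 (θ.res.X P).cub8 (θ.res.X P).toAxial8)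
    (slots₀₆ : ∀ (θ : Stage11Params F N) (hP : θ.Provisos₁₁), θ.Admissible → D = datumOfRecord₁₁ F N θ hP →
      (∀ P, w.up P = upOfRecord₅C F N (θ.toStage5₁₁ F N) P) → ∀ P : B12.RunParams, B9LeafX (θ.res.Y P))
    (slots₀₇ : ∀ (θ : Stage11Params F N) (hP : θ.Provisos₁₁), θ.Admissible → D = datumOfRecord₁₁ F N θ hP →
      (∀ P, w.up P = upOfRecord₅C F N (θ.toStage5₁₁ F N) P) → ∀ P : B12.RunParams, B11Leaf (θ.res.Z P))
    (slots₀₈ : ∀ (θ : Stage11Params F N) (hP : θ.Provisos₁₁), θ.Admissible → D = datumOfRecord₁₁ F N θ hP →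
      (∀ P, w.up P = upOfRecord₅C F N (θ.toStage5₁₁ F N) P) → ∀ P : B12.RunParams,
        ∃ (Xc : PrintedCarriersR) (I : Type) (C : B10Assembly.Consts) (T : I → B10.TowerRun),
          Nonempty (∀ i, B10Assembly.LeafSystem C (T i)) ∧ θ.res.X P = Xc.withTowerRuns10 T)
    (slot12 : ∀ (θ : Stage11Params F N) (hP : θ.Provisos₁₁), θ.Admissible → D = datumOfRecord₁₁ F N θ hP → w.γ ≤ θ.γ →
      (∀ P, w.up P = upOfRecord₅C F N (θ.toStage5₁₁ F N) P) → ∀ P : B12.RunParams, B12Sec2to5.Lemma4Printed (θ.res.X P).F12 (θ.res.X P).c12)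
    (h11dom : ∀ (θ : Stage11Params F N) (hP : θ.Provisos₁₁), θ.Admissible → D = datumOfRecord₁₁ F N θ hP → w.γ ≤ θ.γ →
      ∀ (p : B12.RunParams) (k : ℕ), k ≤ p.K →
        ∀ V ∈ domAltOfRecord F N θ.ν p.K k, UkExists F N p.K k θ.εbg V ∧ UniqueUkOrbit F N p.K k θ.εbg V)
    (hres : ∀ (θ : Stage11Params F N) (hP : θ.Provisos₁₁), θ.Admissible → D = datumOfRecord₁₁ F N θ hP → w.γ ≤ θ.γ →
      ∀ (p : B12.RunParams) (k : ℕ), k ≤ p.K → HRestrict F N θ.εbg p.K k (domAltOfRecord F N θ.ν p.K k))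
    (huniq : ∀ (θ : Stage11Params F N) (hP : θ.Provisos₁₁), θ.Admissible → D = datumOfRecord₁₁ F N θ hP → w.γ ≤ θ.γ →
      ∀ (p : B12.RunParams) (k : ℕ), k ≤ p.K → ∀ V ∈ domAltOfRecord F N θ.ν p.K k, ∀ j < k,
        UniqueUkOrbit F N p.K (j + 1) θ.εbg (Averaging.iter (avOfRecord F N p.K) (j + 1) (Uk F N p.K k θ.εbg V)))
    (slots₁₀ : ∀ (θ : Stage11Params F N) (hP : θ.Provisos₁₁), θ.Admissible → D = datumOfRecord₁₁ F N θ hP →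
      (∀ P, w.up P = upOfRecord₅C F N (θ.toStage5₁₁ F N) P) → ∀ P : B12.RunParams,
        B9LeafX (θ.res.Y P) →
          (B10.Thm1PrintedCompact (θ.res.X P).runs10 ∧ B10.Thm2Printed (θ.res.X P).runs10) →
            B11Leaf (θ.res.Z P) → B12Sec2to5.Lemma4Printed (θ.res.X P).F12 (θ.res.X P).c12 →
              B13.Lemma1Printed (θ.res.X P).S13 (θ.res.X P).c13 ∧ B13.Lemma2Printed (θ.res.X P).S13 (θ.res.X P).c13 ∧
                B13.Lemma3Printed (θ.res.X P).S13 (θ.res.X P).c13)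
    (slots₁₁ : ∀ (θ : Stage11Params F N) (hP : θ.Provisos₁₁), θ.Admissible → D = datumOfRecord₁₁ F N θ hP →
      (∀ P, w.up P = upOfRecord₅C F N (θ.toStage5₁₁ F N) P) → ∀ P : B12.RunParams,
        ((leavesP w P).smallCouplings → SLaw₁₁ F N θ P 0) ∧
        ((leavesP w P).b7 → (leavesP w P).b8 → (leavesP w P).b9 → (leavesP w P).b10 → (leavesP w P).b11 →
          (leavesP w P).smallCouplings → (leavesP w P).smallFieldInductive → (leavesP w P).flowControl →
            ∀ k, k < P.K → SLaw₁₁ F N θ P k → TLaw₁₁ F N θ P k))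
    (slots₁₂ : ∀ (θ : Stage11Params F N) (hP : θ.Provisos₁₁), θ.Admissible → D = datumOfRecord₁₁ F N θ hP →
      (∀ P, w.up P = upOfRecord₅C F N (θ.toStage5₁₁ F N) P) → ∀ P : B12.RunParams, B15Leaf (θ.res.W P))
    (hR : ∀ P : B12.RunParams, (w.up P).rOperation)
    (hcor3 : ∃ (em ep : ℝ → ℝ) (R : B14Cor3.ReprFamily D.C),
      B14Cor3.LeafH D.C R w.γ ∧ B14Cor3.LeafU1 D.C R w.γ ∧ B14Cor3.LeafU2 D.C R w.γ ep ∧ B14Cor3.LeafL1 D.C R w.γ ∧ B14Cor3.LeafL2 D.C R w.γ em)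
    (hβm : ∀ (θ : Stage11Params F N) (hP : θ.Provisos₁₁), θ.Admissible → D = datumOfRecord₁₁ F N θ hP → w.γ ≤ θ.γ →
      letI := θ.instVβ₁; letI := θ.instVβ₂; letI := θ.instιβ
      FlowStep.BetaLowerH w.b w.γ (betaMerged F (mergedTermFamilyMatT F N (TcOfRecord F N) (chiFixed7 F N θ.ν) θ.εbg) θ.ρ8 θ.bV) ∧
        FlowStep.BetaUpperH w.βup w.γ (betaMerged F (mergedTermFamilyMatT F N (TcOfRecord F N) (chiFixed7 F N θ.ν) θ.εbg) θ.ρ8 θ.bV)) :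
    B16.EndStatementBPrinted D.C := by
  obtain ⟨θ, hP, hθ, hD, -, hγ, -, -⟩ := id h
  obtain ⟨hlo, hhi⟩ := hβm θ hP hθ hD hγ.2
  exact N24_at_record₁₁C_knit_N09_N11_pinned h le_rfl slots₀₅ slots₀₆ slots₀₇ slots₀₈ slot12 h11dom hres huniq slots₁₀ slots₁₁ slots₁₂ hR hcor3
    ((N24_betaLowerH_iff_merged₁₁ θ hP hD hγ.2).mpr hlo) ((N24_betaUpperH_iff_merged₁₁ θ hP hD hγ.2).mpr hhi)

/-- **THE β-SEAM RE-KEYED BY NAME TO THE β-SIDE DEFINER'S STAGE-11 β** (seat node00-def-B's `Node00/Record11Beta`, p451949; director LINE №45 (2): the β binder over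
₁₁C NAMED): N24 · (B2) at the Stage-11 record, children as in `N24_at_record₁₁C_knit_N09_N11_pinned`, with the two β-bounds READ ON `betaMergedOfRecord₁₁ F N θ` — the
merged β of record `betaMerged F (mergedTermFamilyMatT (TcOfRecord) (chiFixed7 θ.ν) θ.εbg) θ.ρ8 θ.bV` under its own name — along the world's box `]0, w.γ]^{k+1}` at every
presenting `(θ, h)` (def-B's `hβm` shape verbatim): `D.βfun = betaOfRecord₁₁ F N θ` (`βfun_datumOfRecord₁₁_eq_betaOfRecord₁₁`) and the box bounds transfer between
`betaOfRecord₁₁` and `betaMergedOfRecord₁₁` on `]0, w.γ] ⊆ ]0, θ.γ]` (`betaLowerH_betaOfRecord₁₁_iff` ∕ `betaUpperH_betaOfRecord₁₁_iff`).  β-VERSION (RIDER №6): continuous-version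
transport, point values determined under the record's `contT` (`Record11Beta.exists_betaOfRecord₁₁_of_isRecordOfRecord₁₁C`).  Lower `b > 0` UNPRINTED (T09.F = NODE O); upper β⁺
[Balaban1987RG1] p. 264. [cite: Balaban1989LargeFieldII, Thm 1 p.355, (0.1) pp.355–356, p.391; Balaban1987RG1, (0.19) p.255, (1.20)–(1.22) p.264, (2.12)–(2.14) p.268 (bookkeeping over the Stage-11 record)] -/
theorem N24_at_record₁₁C_knit_N09_N11_of_betaMergedOfRecord₁₁_pinned (h : IsRecordOfRecord₁₁C F N D w)
    (slots₀₅ : ∀ (θ : Stage11Params F N) (hP : θ.Provisos₁₁), θ.Admissible → D = datumOfRecord₁₁ F N θ hP →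
      (∀ P, w.up P = upOfRecord₅C F N (θ.toStage5₁₁ F N) P) → ∀ P : B12.RunParams,
        B8LeafR (θ.res.X P).d8 (θ.res.X P).L8 (θ.res.X P).C₂ (θ.res.X P).B₁' (θ.res.X P).B₀' (θ.res.X P).B₁ (θ.res.X P).B₂ (θ.res.X P).c₁
          (θ.res.X P).inp8 (θ.res.X P).B₀β (θ.res.X P).loc8 (θ.res.X P).fam8R (θ.res.X P).lan8 (θ.res.X P).cub8 (θ.res.X P).toAxial8)
    (slots₀₆ : ∀ (θ : Stage11Params F N) (hP : θ.Provisos₁₁), θ.Admissible → D = datumOfRecord₁₁ F N θ hP →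
      (∀ P, w.up P = upOfRecord₅C F N (θ.toStage5₁₁ F N) P) → ∀ P : B12.RunParams, B9LeafX (θ.res.Y P))
    (slots₀₇ : ∀ (θ : Stage11Params F N) (hP : θ.Provisos₁₁), θ.Admissible → D = datumOfRecord₁₁ F N θ hP →
      (∀ P, w.up P = upOfRecord₅C F N (θ.toStage5₁₁ F N) P) → ∀ P : B12.RunParams, B11Leaf (θ.res.Z P))
    (slots₀₈ : ∀ (θ : Stage11Params F N) (hP : θ.Provisos₁₁), θ.Admissible → D = datumOfRecord₁₁ F N θ hP →
      (∀ P, w.up P = upOfRecord₅C F N (θ.toStage5₁₁ F N) P) → ∀ P : B12.RunParams,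
        ∃ (Xc : PrintedCarriersR) (I : Type) (C : B10Assembly.Consts) (T : I → B10.TowerRun),
          Nonempty (∀ i, B10Assembly.LeafSystem C (T i)) ∧ θ.res.X P = Xc.withTowerRuns10 T)
    (slot12 : ∀ (θ : Stage11Params F N) (hP : θ.Provisos₁₁), θ.Admissible → D = datumOfRecord₁₁ F N θ hP → w.γ ≤ θ.γ →
      (∀ P, w.up P = upOfRecord₅C F N (θ.toStage5₁₁ F N) P) → ∀ P : B12.RunParams, B12Sec2to5.Lemma4Printed (θ.res.X P).F12 (θ.res.X P).c12)
    (h11dom : ∀ (θ : Stage11Params F N) (hP : θ.Provisos₁₁), θ.Admissible → D = datumOfRecord₁₁ F N θ hP → w.γ ≤ θ.γ →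
      ∀ (p : B12.RunParams) (k : ℕ), k ≤ p.K →
        ∀ V ∈ domAltOfRecord F N θ.ν p.K k, UkExists F N p.K k θ.εbg V ∧ UniqueUkOrbit F N p.K k θ.εbg V)
    (hres : ∀ (θ : Stage11Params F N) (hP : θ.Provisos₁₁), θ.Admissible → D = datumOfRecord₁₁ F N θ hP → w.γ ≤ θ.γ →
      ∀ (p : B12.RunParams) (k : ℕ), k ≤ p.K → HRestrict F N θ.εbg p.K k (domAltOfRecord F N θ.ν p.K k))
    (huniq : ∀ (θ : Stage11Params F N) (hP : θ.Provisos₁₁), θ.Admissible → D = datumOfRecord₁₁ F N θ hP → w.γ ≤ θ.γ →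
      ∀ (p : B12.RunParams) (k : ℕ), k ≤ p.K → ∀ V ∈ domAltOfRecord F N θ.ν p.K k, ∀ j < k,
        UniqueUkOrbit F N p.K (j + 1) θ.εbg (Averaging.iter (avOfRecord F N p.K) (j + 1) (Uk F N p.K k θ.εbg V)))
    (slots₁₀ : ∀ (θ : Stage11Params F N) (hP : θ.Provisos₁₁), θ.Admissible → D = datumOfRecord₁₁ F N θ hP →
      (∀ P, w.up P = upOfRecord₅C F N (θ.toStage5₁₁ F N) P) → ∀ P : B12.RunParams,
        B9LeafX (θ.res.Y P) →
          (B10.Thm1PrintedCompact (θ.res.X P).runs10 ∧ B10.Thm2Printed (θ.res.X P).runs10) →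
            B11Leaf (θ.res.Z P) → B12Sec2to5.Lemma4Printed (θ.res.X P).F12 (θ.res.X P).c12 →
              B13.Lemma1Printed (θ.res.X P).S13 (θ.res.X P).c13 ∧ B13.Lemma2Printed (θ.res.X P).S13 (θ.res.X P).c13 ∧
                B13.Lemma3Printed (θ.res.X P).S13 (θ.res.X P).c13)
    (slots₁₁ : ∀ (θ : Stage11Params F N) (hP : θ.Provisos₁₁), θ.Admissible → D = datumOfRecord₁₁ F N θ hP →
      (∀ P, w.up P = upOfRecord₅C F N (θ.toStage5₁₁ F N) P) → ∀ P : B12.RunParams,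
        ((leavesP w P).smallCouplings → SLaw₁₁ F N θ P 0) ∧
        ((leavesP w P).b7 → (leavesP w P).b8 → (leavesP w P).b9 → (leavesP w P).b10 → (leavesP w P).b11 →
          (leavesP w P).smallCouplings → (leavesP w P).smallFieldInductive → (leavesP w P).flowControl →
            ∀ k, k < P.K → SLaw₁₁ F N θ P k → TLaw₁₁ F N θ P k))
    (slots₁₂ : ∀ (θ : Stage11Params F N) (hP : θ.Provisos₁₁), θ.Admissible → D = datumOfRecord₁₁ F N θ hP →
      (∀ P, w.up P = upOfRecord₅C F N (θ.toStage5₁₁ F N) P) → ∀ P : B12.RunParams, B15Leaf (θ.res.W P))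
    (hR : ∀ P : B12.RunParams, (w.up P).rOperation)
    (hcor3 : ∃ (em ep : ℝ → ℝ) (R : B14Cor3.ReprFamily D.C),
      B14Cor3.LeafH D.C R w.γ ∧ B14Cor3.LeafU1 D.C R w.γ ∧ B14Cor3.LeafU2 D.C R w.γ ep ∧ B14Cor3.LeafL1 D.C R w.γ ∧ B14Cor3.LeafL2 D.C R w.γ em)
    (hβm : ∀ (θ : Stage11Params F N) (hP : θ.Provisos₁₁), θ.Admissible → D = datumOfRecord₁₁ F N θ hP → w.γ ≤ θ.γ →
      FlowStep.BetaLowerH w.b w.γ (betaMergedOfRecord₁₁ F N θ) ∧ FlowStep.BetaUpperH w.βup w.γ (betaMergedOfRecord₁₁ F N θ)) :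
    B16.EndStatementBPrinted D.C := by
  obtain ⟨θ, hP, hθ, hD, -, hγ, -, -⟩ := id h
  obtain ⟨hlo, hhi⟩ := hβm θ hP hθ hD hγ.2
  have hβ : D.βfun = betaOfRecord₁₁ F N θ := by rw [hD]; exact βfun_datumOfRecord₁₁_eq_betaOfRecord₁₁ F N θ hP
  refine N24_at_record₁₁C_knit_N09_N11_pinned h le_rfl slots₀₅ slots₀₆ slots₀₇ slots₀₈ slot12 h11dom hres huniq slots₁₀ slots₁₁ slots₁₂ hR hcor3 ?_ ?_
  · rw [hβ]; exact (betaLowerH_betaOfRecord₁₁_iff θ hγ.2).mpr hlo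
  · rw [hβ]; exact (betaUpperH_betaOfRecord₁₁_iff θ hγ.2).mpr hhi

/-! ## §2. The K1 item body in its literal shape at a Stage-11 record, N09 and N11 by name -/

/-- **The CONSEQUENT of item K1 `StabilityBAtRecordR11e` (stmt-QuantumFields-19674) in its LITERAL SHAPE at general `N`, WITNESSED BY THE RECORD AT HAND**, children as in
`N24_at_record₁₁C_knit_N09_N11_pinned`: `IsRecordOfRecord₁₁C F N D w ∧ B16.EndStatementBPrinted D.C ∧ ∃ γ₁ > 0, ∀ γ ∈ ]0, γ₁], ∃ P, 1 ≤ P.K ∧ (D.C P).flow.InInterval γ P.K`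
— the record clause is `h`, (B2) by §1, the window PRODUCED from `hhi` by module 8's K-indexed window `N24_window_allK_of_betaUpperH` at any length `K ≥ 1` and torus exponent
`m`.  COMPOSITE: (B2) GIVEN the children; nothing discharged. [cite: Balaban1989LargeFieldII, Thm 1 p.355 + p.391; Balaban1987RG1, (0.17)–(0.20) pp.255–256 and p.264 (bookkeeping + elementary window)] -/
theorem N24_stabilityBR11e_shape₁₁C_knit_N09_N11_pinned (h : IsRecordOfRecord₁₁C F N D w) {γ₀ : ℝ} (hγ₀ : w.γ ≤ γ₀) {K : ℕ} (hK : 1 ≤ K) (m : ℕ)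
    (slots₀₅ : ∀ (θ : Stage11Params F N) (hP : θ.Provisos₁₁), θ.Admissible → D = datumOfRecord₁₁ F N θ hP →
      (∀ P, w.up P = upOfRecord₅C F N (θ.toStage5₁₁ F N) P) → ∀ P : B12.RunParams,
        B8LeafR (θ.res.X P).d8 (θ.res.X P).L8 (θ.res.X P).C₂ (θ.res.X P).B₁' (θ.res.X P).B₀' (θ.res.X P).B₁ (θ.res.X P).B₂ (θ.res.X P).c₁
          (θ.res.X P).inp8 (θ.res.X P).B₀β (θ.res.X P).loc8 (θ.res.X P).fam8R (θ.res.X P).lan8 (θ.res.X P).cub8 (θ.res.X P).toAxial8)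
    (slots₀₆ : ∀ (θ : Stage11Params F N) (hP : θ.Provisos₁₁), θ.Admissible → D = datumOfRecord₁₁ F N θ hP →
      (∀ P, w.up P = upOfRecord₅C F N (θ.toStage5₁₁ F N) P) → ∀ P : B12.RunParams, B9LeafX (θ.res.Y P))
    (slots₀₇ : ∀ (θ : Stage11Params F N) (hP : θ.Provisos₁₁), θ.Admissible → D = datumOfRecord₁₁ F N θ hP →
      (∀ P, w.up P = upOfRecord₅C F N (θ.toStage5₁₁ F N) P) → ∀ P : B12.RunParams, B11Leaf (θ.res.Z P))
    (slots₀₈ : ∀ (θ : Stage11Params F N) (hP : θ.Provisos₁₁), θ.Admissible → D = datumOfRecord₁₁ F N θ hP →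
      (∀ P, w.up P = upOfRecord₅C F N (θ.toStage5₁₁ F N) P) → ∀ P : B12.RunParams,
        ∃ (Xc : PrintedCarriersR) (I : Type) (C : B10Assembly.Consts) (T : I → B10.TowerRun),
          Nonempty (∀ i, B10Assembly.LeafSystem C (T i)) ∧ θ.res.X P = Xc.withTowerRuns10 T)
    (slot12 : ∀ (θ : Stage11Params F N) (hP : θ.Provisos₁₁), θ.Admissible → D = datumOfRecord₁₁ F N θ hP → w.γ ≤ θ.γ →
      (∀ P, w.up P = upOfRecord₅C F N (θ.toStage5₁₁ F N) P) → ∀ P : B12.RunParams, B12Sec2to5.Lemma4Printed (θ.res.X P).F12 (θ.res.X P).c12)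
    (h11dom : ∀ (θ : Stage11Params F N) (hP : θ.Provisos₁₁), θ.Admissible → D = datumOfRecord₁₁ F N θ hP → w.γ ≤ θ.γ →
      ∀ (p : B12.RunParams) (k : ℕ), k ≤ p.K →
        ∀ V ∈ domAltOfRecord F N θ.ν p.K k, UkExists F N p.K k θ.εbg V ∧ UniqueUkOrbit F N p.K k θ.εbg V)
    (hres : ∀ (θ : Stage11Params F N) (hP : θ.Provisos₁₁), θ.Admissible → D = datumOfRecord₁₁ F N θ hP → w.γ ≤ θ.γ →
      ∀ (p : B12.RunParams) (k : ℕ), k ≤ p.K → HRestrict F N θ.εbg p.K k (domAltOfRecord F N θ.ν p.K k))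
    (huniq : ∀ (θ : Stage11Params F N) (hP : θ.Provisos₁₁), θ.Admissible → D = datumOfRecord₁₁ F N θ hP → w.γ ≤ θ.γ →
      ∀ (p : B12.RunParams) (k : ℕ), k ≤ p.K → ∀ V ∈ domAltOfRecord F N θ.ν p.K k, ∀ j < k,
        UniqueUkOrbit F N p.K (j + 1) θ.εbg (Averaging.iter (avOfRecord F N p.K) (j + 1) (Uk F N p.K k θ.εbg V)))
    (slots₁₀ : ∀ (θ : Stage11Params F N) (hP : θ.Provisos₁₁), θ.Admissible → D = datumOfRecord₁₁ F N θ hP →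
      (∀ P, w.up P = upOfRecord₅C F N (θ.toStage5₁₁ F N) P) → ∀ P : B12.RunParams,
        B9LeafX (θ.res.Y P) →
          (B10.Thm1PrintedCompact (θ.res.X P).runs10 ∧ B10.Thm2Printed (θ.res.X P).runs10) →
            B11Leaf (θ.res.Z P) → B12Sec2to5.Lemma4Printed (θ.res.X P).F12 (θ.res.X P).c12 →
              B13.Lemma1Printed (θ.res.X P).S13 (θ.res.X P).c13 ∧ B13.Lemma2Printed (θ.res.X P).S13 (θ.res.X P).c13 ∧
                B13.Lemma3Printed (θ.res.X P).S13 (θ.res.X P).c13)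
    (slots₁₁ : ∀ (θ : Stage11Params F N) (hP : θ.Provisos₁₁), θ.Admissible → D = datumOfRecord₁₁ F N θ hP →
      (∀ P, w.up P = upOfRecord₅C F N (θ.toStage5₁₁ F N) P) → ∀ P : B12.RunParams,
        ((leavesP w P).smallCouplings → SLaw₁₁ F N θ P 0) ∧
        ((leavesP w P).b7 → (leavesP w P).b8 → (leavesP w P).b9 → (leavesP w P).b10 → (leavesP w P).b11 →
          (leavesP w P).smallCouplings → (leavesP w P).smallFieldInductive → (leavesP w P).flowControl →
            ∀ k, k < P.K → SLaw₁₁ F N θ P k → TLaw₁₁ F N θ P k))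
    (slots₁₂ : ∀ (θ : Stage11Params F N) (hP : θ.Provisos₁₁), θ.Admissible → D = datumOfRecord₁₁ F N θ hP →
      (∀ P, w.up P = upOfRecord₅C F N (θ.toStage5₁₁ F N) P) → ∀ P : B12.RunParams, B15Leaf (θ.res.W P))
    (hR : ∀ P : B12.RunParams, (w.up P).rOperation)
    (hcor3 : ∃ (em ep : ℝ → ℝ) (R : B14Cor3.ReprFamily D.C),
      B14Cor3.LeafH D.C R w.γ ∧ B14Cor3.LeafU1 D.C R w.γ ∧ B14Cor3.LeafU2 D.C R w.γ ep ∧ B14Cor3.LeafL1 D.C R w.γ ∧ B14Cor3.LeafL2 D.C R w.γ em)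
    (hlo : FlowStep.BetaLowerH w.b γ₀ D.βfun) (hhi : FlowStep.BetaUpperH w.βup γ₀ D.βfun) :
    IsRecordOfRecord₁₁C F N D w ∧ B16.EndStatementBPrinted D.C ∧
      ∃ γ₁ : ℝ, 0 < γ₁ ∧ ∀ γ : ℝ, 0 < γ → γ ≤ γ₁ → ∃ P : B12.RunParams, 1 ≤ P.K ∧ (D.C P).flow.InInterval γ P.K := by
  refine ⟨h, N24_at_record₁₁C_knit_N09_N11_pinned h hγ₀ slots₀₅ slots₀₆ slots₀₇ slots₀₈ slot12 h11dom hres huniq slots₁₀ slots₁₁ slots₁₂ hR hcor3 hlo hhi,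
    γ₀, (gamma_pos_of_isRecordOfRecord₁₁C h).trans_le hγ₀, fun γ hγ hγle => ?_⟩
  obtain ⟨g0, -, hrun⟩ := N24_window_allK_of_betaUpperH D hhi hγ hγle m K
  exact ⟨⟨K, m, g0⟩, hK, hrun⟩

/-- **… and in the item's ∃-form** — the consequent of `StabilityBAtRecordR11e` VERBATIM at general `N` (window run of length `K := 1`, torus exponent `m := 0`), from ONE
Stage-11 record whose children hold. [cite: Balaban1989LargeFieldII, Thm 1 p.355 + p.391; Balaban1987RG1, (0.17)–(0.20) pp.255–256 (bookkeeping)] -/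
theorem N24_stabilityBR11e_consequent₁₁C_knit_N09_N11_pinned (h : IsRecordOfRecord₁₁C F N D w) {γ₀ : ℝ} (hγ₀ : w.γ ≤ γ₀)
    (slots₀₅ : ∀ (θ : Stage11Params F N) (hP : θ.Provisos₁₁), θ.Admissible → D = datumOfRecord₁₁ F N θ hP →
      (∀ P, w.up P = upOfRecord₅C F N (θ.toStage5₁₁ F N) P) → ∀ P : B12.RunParams,
        B8LeafR (θ.res.X P).d8 (θ.res.X P).L8 (θ.res.X P).C₂ (θ.res.X P).B₁' (θ.res.X P).B₀' (θ.res.X P).B₁ (θ.res.X P).B₂ (θ.res.X P).c₁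
          (θ.res.X P).inp8 (θ.res.X P).B₀β (θ.res.X P).loc8 (θ.res.X P).fam8R (θ.res.X P).lan8 (θ.res.X P).cub8 (θ.res.X P).toAxial8)
    (slots₀₆ : ∀ (θ : Stage11Params F N) (hP : θ.Provisos₁₁), θ.Admissible → D = datumOfRecord₁₁ F N θ hP →
      (∀ P, w.up P = upOfRecord₅C F N (θ.toStage5₁₁ F N) P) → ∀ P : B12.RunParams, B9LeafX (θ.res.Y P))
    (slots₀₇ : ∀ (θ : Stage11Params F N) (hP : θ.Provisos₁₁), θ.Admissible → D = datumOfRecord₁₁ F N θ hP →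
      (∀ P, w.up P = upOfRecord₅C F N (θ.toStage5₁₁ F N) P) → ∀ P : B12.RunParams, B11Leaf (θ.res.Z P))
    (slots₀₈ : ∀ (θ : Stage11Params F N) (hP : θ.Provisos₁₁), θ.Admissible → D = datumOfRecord₁₁ F N θ hP →
      (∀ P, w.up P = upOfRecord₅C F N (θ.toStage5₁₁ F N) P) → ∀ P : B12.RunParams,
        ∃ (Xc : PrintedCarriersR) (I : Type) (C : B10Assembly.Consts) (T : I → B10.TowerRun),
          Nonempty (∀ i, B10Assembly.LeafSystem C (T i)) ∧ θ.res.X P = Xc.withTowerRuns10 T)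
    (slot12 : ∀ (θ : Stage11Params F N) (hP : θ.Provisos₁₁), θ.Admissible → D = datumOfRecord₁₁ F N θ hP → w.γ ≤ θ.γ →
      (∀ P, w.up P = upOfRecord₅C F N (θ.toStage5₁₁ F N) P) → ∀ P : B12.RunParams, B12Sec2to5.Lemma4Printed (θ.res.X P).F12 (θ.res.X P).c12)
    (h11dom : ∀ (θ : Stage11Params F N) (hP : θ.Provisos₁₁), θ.Admissible → D = datumOfRecord₁₁ F N θ hP → w.γ ≤ θ.γ →
      ∀ (p : B12.RunParams) (k : ℕ), k ≤ p.K →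
        ∀ V ∈ domAltOfRecord F N θ.ν p.K k, UkExists F N p.K k θ.εbg V ∧ UniqueUkOrbit F N p.K k θ.εbg V)
    (hres : ∀ (θ : Stage11Params F N) (hP : θ.Provisos₁₁), θ.Admissible → D = datumOfRecord₁₁ F N θ hP → w.γ ≤ θ.γ →
      ∀ (p : B12.RunParams) (k : ℕ), k ≤ p.K → HRestrict F N θ.εbg p.K k (domAltOfRecord F N θ.ν p.K k))
    (huniq : ∀ (θ : Stage11Params F N) (hP : θ.Provisos₁₁), θ.Admissible → D = datumOfRecord₁₁ F N θ hP → w.γ ≤ θ.γ →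
      ∀ (p : B12.RunParams) (k : ℕ), k ≤ p.K → ∀ V ∈ domAltOfRecord F N θ.ν p.K k, ∀ j < k,
        UniqueUkOrbit F N p.K (j + 1) θ.εbg (Averaging.iter (avOfRecord F N p.K) (j + 1) (Uk F N p.K k θ.εbg V)))
    (slots₁₀ : ∀ (θ : Stage11Params F N) (hP : θ.Provisos₁₁), θ.Admissible → D = datumOfRecord₁₁ F N θ hP →
      (∀ P, w.up P = upOfRecord₅C F N (θ.toStage5₁₁ F N) P) → ∀ P : B12.RunParams,
        B9LeafX (θ.res.Y P) →
          (B10.Thm1PrintedCompact (θ.res.X P).runs10 ∧ B10.Thm2Printed (θ.res.X P).runs10) →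
            B11Leaf (θ.res.Z P) → B12Sec2to5.Lemma4Printed (θ.res.X P).F12 (θ.res.X P).c12 →
              B13.Lemma1Printed (θ.res.X P).S13 (θ.res.X P).c13 ∧ B13.Lemma2Printed (θ.res.X P).S13 (θ.res.X P).c13 ∧
                B13.Lemma3Printed (θ.res.X P).S13 (θ.res.X P).c13)
    (slots₁₁ : ∀ (θ : Stage11Params F N) (hP : θ.Provisos₁₁), θ.Admissible → D = datumOfRecord₁₁ F N θ hP →
      (∀ P, w.up P = upOfRecord₅C F N (θ.toStage5₁₁ F N) P) → ∀ P : B12.RunParams,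
        ((leavesP w P).smallCouplings → SLaw₁₁ F N θ P 0) ∧
        ((leavesP w P).b7 → (leavesP w P).b8 → (leavesP w P).b9 → (leavesP w P).b10 → (leavesP w P).b11 →
          (leavesP w P).smallCouplings → (leavesP w P).smallFieldInductive → (leavesP w P).flowControl →
            ∀ k, k < P.K → SLaw₁₁ F N θ P k → TLaw₁₁ F N θ P k))
    (slots₁₂ : ∀ (θ : Stage11Params F N) (hP : θ.Provisos₁₁), θ.Admissible → D = datumOfRecord₁₁ F N θ hP →
      (∀ P, w.up P = upOfRecord₅C F N (θ.toStage5₁₁ F N) P) → ∀ P : B12.RunParams, B15Leaf (θ.res.W P))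
    (hR : ∀ P : B12.RunParams, (w.up P).rOperation)
    (hcor3 : ∃ (em ep : ℝ → ℝ) (R : B14Cor3.ReprFamily D.C),
      B14Cor3.LeafH D.C R w.γ ∧ B14Cor3.LeafU1 D.C R w.γ ∧ B14Cor3.LeafU2 D.C R w.γ ep ∧ B14Cor3.LeafL1 D.C R w.γ ∧ B14Cor3.LeafL2 D.C R w.γ em)
    (hlo : FlowStep.BetaLowerH w.b γ₀ D.βfun) (hhi : FlowStep.BetaUpperH w.βup γ₀ D.βfun) :
    ∃ (D' : FiniteEpsData F (SU N)) (w' : WorldP), IsRecordOfRecord₁₁C F N D' w' ∧ B16.EndStatementBPrinted D'.C ∧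
      ∃ γ₁ : ℝ, 0 < γ₁ ∧ ∀ γ : ℝ, 0 < γ → γ ≤ γ₁ → ∃ P : B12.RunParams, 1 ≤ P.K ∧ (D'.C P).flow.InInterval γ P.K :=
  ⟨D, w, N24_stabilityBR11e_shape₁₁C_knit_N09_N11_pinned h hγ₀ le_rfl 0 slots₀₅ slots₀₆ slots₀₇ slots₀₈ slot12 h11dom hres huniq slots₁₀ slots₁₁ slots₁₂
    hR hcor3 hlo hhi⟩

/-! ## §3. At the top of the four-pin Stage-11 carrier chain `IsRecordOfRecord₁₁CB10YZW` (same datum, same world), N09 and N11 by name -/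

/-- **N24 · (B2) AT THE FOUR-PIN STAGE-11 RECORD, THE PINNED CHILDREN AT THEIR STATEMENTS OF RECORD, N09 AND N11 BY NAME, N13 WORLD-LEVEL** (module 21 §1's recipe with
§0's N11 and dag-n09-d's N09): **N08** ← the printed slot `PrintedUV3V N L` at the world's odd block size `L > 1`; **N06 ∧ N07 ∧ N12** ← the hidden layers' leaves `hYZW`
(junk-closable — location-positive, strength-neutral); **N05 ∕ N10** θ-keyed sockets on X-[B8] ∕ X-B13 over `θ.toStage5₁₁` (every ₁₁C presentation, the pinned one included);
**N09** ×4; **N11** ×2; **N13** `hR` + `hcor3`; β-box on `D.βfun`.  WHICH CHILD BLOCKS at `₁₁CB10YZW`, kernel form: N08 one printed ∃-slot; N06 ∧ N07 ∧ N12 hidden-layer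
leaves; two residual sockets; N09 ×4; N11 ×2; N13 𝐑-leaf + Cor.-3; β ×2; K0 at ₁₁. [cite: Balaban1989LargeFieldII, Thm 1 p.355, (0.1) pp.355–356, p.387, p.391; Balaban1985UV3, (1)–(5) p.256, Thm 1 p.257 + Thm 2 p.272; Balaban1985BackgroundPropagators, Thms 3.1–3.15 pp.397–432; Balaban1985Variational, Thm 1 p.279; Balaban1988Convergent, Thm 1 p.262, Theorem p.245, p.244, Cor. 3 (2.50) p.264; Balaban1987RG1, Thm 3 p.264, Lemma 4 (3.53) p.280, (1.1)–(1.3) p.260, (1.22) p.264; Balaban1985RegularSpaces, Thms 2, 4, 8 pp.83–101; Balaban1988RG2Cluster, Lemmas 1–3 pp.9, 11, 20; Balaban1989LargeFieldI, Prop. 1 p.194 (bookkeeping over the carrier-pinned Stage-11 record)] -/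
theorem N24_at_record₁₁CB10YZW_knit_all_carriers_N09_N11_pinned (h : IsRecordOfRecord₁₁CB10YZW F N D w) {γ₀ : ℝ} (hγ₀ : w.γ ≤ γ₀)
    (slots₀₅ : ∀ (θ : Stage11Params F N) (hP : θ.Provisos₁₁), θ.Admissible → D = datumOfRecord₁₁ F N θ hP →
      (∀ P, w.up P = upOfRecord₅C F N (θ.toStage5₁₁ F N) P) → ∀ P : B12.RunParams,
        B8LeafR (θ.res.X P).d8 (θ.res.X P).L8 (θ.res.X P).C₂ (θ.res.X P).B₁' (θ.res.X P).B₀' (θ.res.X P).B₁ (θ.res.X P).B₂ (θ.res.X P).c₁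
          (θ.res.X P).inp8 (θ.res.X P).B₀β (θ.res.X P).loc8 (θ.res.X P).fam8R (θ.res.X P).lan8 (θ.res.X P).cub8 (θ.res.X P).toAxial8)
    (hYZW : ∀ (θ : Stage11Params F N) (hP : θ.Provisos₁₁) (Mstar : ℕ) (ops : OpsY N θ.toStage3Params Mstar) (ζ : ResidZ F N) (lamW : ResidW F N),
      θ.Admissible → D = datumOfRecord₁₁ F N θ hP → (∀ P, w.up P = upOfRecord₅C F N (θ.view₁₁B10YZW F N Mstar ops ζ lamW) P) →
        B9LeafX (Y9OfRecord N θ.toStage3Params Mstar ops) ∧ B11Leaf (Z11OfRecord F N ζ) ∧ ∀ P : B12.RunParams, B15Leaf (WOfRecord₁₁ F N θ lamW P))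
    (hUV₀₈ : ∀ L : ℕ, Odd L → 1 < L → w.L = (L : ℝ) → PrintedUV3V N L)
    (slot12 : ∀ (θ : Stage11Params F N) (hP : θ.Provisos₁₁), θ.Admissible → D = datumOfRecord₁₁ F N θ hP → w.γ ≤ θ.γ →
      (∀ P, w.up P = upOfRecord₅C F N (θ.toStage5₁₁ F N) P) → ∀ P : B12.RunParams, B12Sec2to5.Lemma4Printed (θ.res.X P).F12 (θ.res.X P).c12)
    (h11dom : ∀ (θ : Stage11Params F N) (hP : θ.Provisos₁₁), θ.Admissible → D = datumOfRecord₁₁ F N θ hP → w.γ ≤ θ.γ →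
      ∀ (p : B12.RunParams) (k : ℕ), k ≤ p.K →
        ∀ V ∈ domAltOfRecord F N θ.ν p.K k, UkExists F N p.K k θ.εbg V ∧ UniqueUkOrbit F N p.K k θ.εbg V)
    (hres : ∀ (θ : Stage11Params F N) (hP : θ.Provisos₁₁), θ.Admissible → D = datumOfRecord₁₁ F N θ hP → w.γ ≤ θ.γ →
      ∀ (p : B12.RunParams) (k : ℕ), k ≤ p.K → HRestrict F N θ.εbg p.K k (domAltOfRecord F N θ.ν p.K k))
    (huniq : ∀ (θ : Stage11Params F N) (hP : θ.Provisos₁₁), θ.Admissible → D = datumOfRecord₁₁ F N θ hP → w.γ ≤ θ.γ →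
      ∀ (p : B12.RunParams) (k : ℕ), k ≤ p.K → ∀ V ∈ domAltOfRecord F N θ.ν p.K k, ∀ j < k,
        UniqueUkOrbit F N p.K (j + 1) θ.εbg (Averaging.iter (avOfRecord F N p.K) (j + 1) (Uk F N p.K k θ.εbg V)))
    (slots₁₀ : ∀ (θ : Stage11Params F N) (hP : θ.Provisos₁₁), θ.Admissible → D = datumOfRecord₁₁ F N θ hP →
      (∀ P, w.up P = upOfRecord₅C F N (θ.toStage5₁₁ F N) P) → ∀ P : B12.RunParams,
        B9LeafX (θ.res.Y P) →
          (B10.Thm1PrintedCompact (θ.res.X P).runs10 ∧ B10.Thm2Printed (θ.res.X P).runs10) →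
            B11Leaf (θ.res.Z P) → B12Sec2to5.Lemma4Printed (θ.res.X P).F12 (θ.res.X P).c12 →
              B13.Lemma1Printed (θ.res.X P).S13 (θ.res.X P).c13 ∧ B13.Lemma2Printed (θ.res.X P).S13 (θ.res.X P).c13 ∧
                B13.Lemma3Printed (θ.res.X P).S13 (θ.res.X P).c13)
    (slots₁₁ : ∀ (θ : Stage11Params F N) (hP : θ.Provisos₁₁), θ.Admissible → D = datumOfRecord₁₁ F N θ hP →
      (∀ P, w.up P = upOfRecord₅C F N (θ.toStage5₁₁ F N) P) → ∀ P : B12.RunParams,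
        ((leavesP w P).smallCouplings → SLaw₁₁ F N θ P 0) ∧
        ((leavesP w P).b7 → (leavesP w P).b8 → (leavesP w P).b9 → (leavesP w P).b10 → (leavesP w P).b11 →
          (leavesP w P).smallCouplings → (leavesP w P).smallFieldInductive → (leavesP w P).flowControl →
            ∀ k, k < P.K → SLaw₁₁ F N θ P k → TLaw₁₁ F N θ P k))
    (hR : ∀ P : B12.RunParams, (w.up P).rOperation)
    (hcor3 : ∃ (em ep : ℝ → ℝ) (R : B14Cor3.ReprFamily D.C),
      B14Cor3.LeafH D.C R w.γ ∧ B14Cor3.LeafU1 D.C R w.γ ∧ B14Cor3.LeafU2 D.C R w.γ ep ∧ B14Cor3.LeafL1 D.C R w.γ ∧ B14Cor3.LeafL2 D.C R w.γ em)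
    (hlo : FlowStep.BetaLowerH w.b γ₀ D.βfun) (hhi : FlowStep.BetaUpperH w.βup γ₀ D.βfun) :
    B16.EndStatementBPrinted D.C :=
  have h₁₁ := isRecordOfRecord₁₁C_of_isRecordOfRecord₁₁CB10YZW h
  have h3 := b9_b11_b15_main_of_isRecordOfRecord₁₁CB10YZW_of_slots h hYZW
  N24_at_record₁₁C_of_N13_leaf h₁₁ hγ₀ (N24_b8_main_of_isRecordOfRecord₁₁C_of_slot h₁₁ slots₀₅) (fun P => (h3 P).1) (fun P => (h3 P).2.1)
    (N24_b10_main_of_isRecordOfRecord₁₁CB10YZW_of_printedUV3V h hUV₀₈)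
    (B12NodeKnitRecord11.b12_main_at_record₁₁C_of_leaf h₁₁ slot12 h11dom hres huniq) (N24_b13_main_of_isRecordOfRecord₁₁C_of_slot h₁₁ slots₁₀)
    (N24_b14_main_of_isRecordOfRecord₁₁C_of_slots h₁₁ slots₁₁) (fun P => (h3 P).2.2) hR hcor3 hlo hhi

end Literature.MathematicalPhysics.QuantumFieldTheory.Balaban1983to89.Node00

end
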